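import Summits.QuantumFields.BalabanUV.T4Continuum.Spine.NE1p.DressedSourceAnalyticSlotLetters

/-!
# T⁴ programme, spine estimate NE1′ (node O3b/H2) — THE (w5) REGENERATION CONSTANT AT THE CORES AND AT THE SUBSTRATE'S GAUSSIAN
# LETTERS OF RECORD, (B1a) DISCHARGED: N0j's third small-field END `regenPart_locE_le` (the STRENGTH pencil `h₀ + s • v` on
# `‖s‖ < ϱ`, `1 < ϱ`) carried through exactly the junctions S33 §3∕§4 and S46 §2 built for the holomorphy and response ENDs

Cell `pub-balaban`, sub-cell `t4`, BINDER-OWNERS row NE1′; NE1′ formalisation crew, unit `b2b-balaban-t4-ne1p-formalise-leaf-03`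
(LEAF PROVER 03, generation 14); crew row S52 ∕ DAG N29zzzq of `t4/formal/NE1p/LEAVES.md` (INTENT journal l.21809, BOOKED typer R-T136 ∕ R-T137 l.22015; own-lineage follower of S33
`DressedSourceAnalyticOnCores` (p230131), S46 `DressedSourceAnalyticSlotLetters` (p235653), in crew row S30
`DressedSmallFieldOnCoresSlotLetters` (leaf-01, p228879)'s scope and pattern), module A of two (module B = the torus forms).  ADDITIVE —
imports S46 `Spine/NE1p/DressedSourceAnalyticSlotLetters` ONLY (→ S42 → S33 → N0r∕N0q∕N0p∕N0n∕N0j, row NE5's `B13Term*`, the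
substrate's `SubstrateActivities` ∕ `SubstrateSlotsOfRecord`; → S30 §1's block producers); THEOREMS ONLY (0 def, 0 `def … : Prop`,
0 cite); nothing of those modules is restated — their declarations are used BY NAME.

WHY THIS FILE.  N0j `DressedSmallFieldPencil` types THREE small-field ENDs of the dressed output `E[act s](X₀)` along a pencil in the
table: the holomorphy ∕ (2.41)-envelope face (N0n's parametric form), the LINEAR RESPONSE `muDeriv_locE_le` (source pencil, radius
`μ₁`, the face feeding `DressedSmallFieldAllowance`) and the (w5) REGENERATION CONSTANT `regenPart_locE_le` (STRENGTH pencil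
`s ↦ h₀ + s • v` of radius `ϱ > 1`; the booked family is `s = 1`, the unregenerated one `s = 0`; Cauchy on the circle of radius `ϱ`
gives `‖E[act 1](X₀) − E[act 0](X₀)‖ ≤ M(ϱ)∕(ϱ − 1)`).  This unit's S33 discharged (B1a)'s per-polymer (E1)∕(E2) binders for ALL
THREE at the exp-linear level (§2: `analytic_and_bounded_locE_param_of_expLinear`, `muDeriv_locE_le_of_expLinear`,
`regenPart_locE_le_of_expLinear`, row NE5's structural SHAPE `TermHistExpLinear`), but carried only the FIRST TWO further — to
(2.14)-cores with term-dependent polymer families and a letter budget (S33 §3), to the substrate's slot activities `actOfLetters` (S33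
§4), and (S46 §2, S50) to the Gaussian letters of record `coreLettersOf A` and the slots of record; `regenPart_locE_le_of_expLinear`
had NO applier in `Spine/NE1p` ∕ `Support` (tree of 209 + 2 modules, 2026-08-20): the (w5) regeneration constant — a named conjunct
«(w5)∕(w5b)» of the wall of record — stopped at the exp-linear level, and every other carrier of N0j's third END (S24 §1∕§2
`regenPart_locE_le_of_geometry` ∕ `_torus`, the owner's `DressedSmallFieldInduction` §2, the decided toys W24 ∕ W36) keeps (E1)∕(E2)
DISPLAYED.  This file closes that column with the SAME three junctions, nothing else:
* §1 `regenPart_locE_le_of_coresAt_pencil_mass` (kernel; S33 §2 `regenPart_locE_le_of_expLinear` ONCE BY NAME with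
  `hexp := termHistExpLinear_termAt` (N0r §1), pencil data by N0p's `pencil_mem_ballClass` ∕ `norm_pencil_le` AT THE STRENGTH RADIUS
  `ϱ`, read-out bounds by the cores' `N₁`, (B3) as N0q's letter budget `hM3` via `norm_integral_coreDensity_le` termwise — S33 §3's
  proof VERBATIM with `μ₁ ↦ ϱ`).  Binders = S33 §3 `muDeriv_locE_le_of_coresAt_pencil_mass`'s with `μ₁ ↦ ϱ`, MINUS [`μ₀`, `sμ`,
  `h01`, `hμ`] PLUS [`hϱ : 1 < ϱ`].
* §2 `regenPart_locE_le_of_actOfLetters` (kernel; §1 at the term index `Pol × J`, `𝔊 k p X := coreOf ℓ p.1 p.2`, `hact` BY `rfl` —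
  S33 §4's pattern VERBATIM).
* §3 `regenPart_locE_le_of_coreLettersOf` (kernel; §2 ONCE BY NAME at `ℓ := coreLettersOf D P Op 𝒵 dom Jc V mI A`, letters
  `N₀ k p X := gaussC (mI p.1 p.2)·√(max 1 (card!·β₀^{card} + d₀))`, `mq k p X := (γ − card·ϑ·R′ k)∕2`, `bq := 0`, N0r's three
  operator-letter blocks PRODUCED by S30 §1 `margin_pos` ∕ `hN_coreLettersOf` ∕ `hq_coreLettersOf` — S46 §2's pattern VERBATIM).

WHAT STAYS DISPLAYED (binders, by name; NOTHING instantiated on Bałaban's densities): the room `hroom`; the Gaussian letter blocks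
`hm` ∕ `hN` ∕ `hq` on the open operator ball (§1∕§2) — resp. (§3) the substrate's PRIMITIVE per-factor scalar letter conditions
`hbase` ∕ `hrdm` ∕ `hβ₀` ∕ `hd₀` ∕ `hrd`, the CENTRE CONDITIONS `hctr` at every class centre and the radius smallnesses `hbud` ∕ `hmq`
(S30's S-U3 currency); `hO` ∕ `hH` AT THE STRENGTH RADIUS `ϱ` (the whole pencil `h₀ + s • v`, `‖s‖ < ϱ`, inside the table ball of
the class — N0j's (w5) reading: the regenerated family is reached INSIDE the analyticity window with margin `ϱ − 1`); (B1b)'s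
residue `terms` ∕ `emb` ∕ `hscale`; the geometry `G`; the located clause SHAPES «κ large» `r₁ + 2κ₀ + 2 ≤ R` and «ε₁ small»
`A·e^{b₅+1}·K₀·ν·c₁ ≤ 1` with `5r₁ ≤ b₅` ((B5)-KIND); (B3) = `hM3` — GAPS G-ne9p2-5, UNPRINTED, shared with NE9, a BINDER, never
`[cite:`-tagged.  WHICH tables are Bałaban's 𝐕_k and 𝐖 (the STRENGTH direction `v`), whether the datum of record meets the centre
conditions, and the identification of the cores ∕ letters with [Balaban1988RGII] (2.14) p. 15 are the substrate's and S30's DISPLAYED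
READINGS, not asserted here; (2.14) p. 15, (2.38) p. 20, (2.41) p. 21 are LOCI (TYPE∕CONTEXT) quoted in the imported modules with
their tags; no numeral of print enters.

READING OF THE CONSTANT (N0j's author, owner g31, journal l.21941; N0j ∕ S33's words).  `hϱ : 1 < ϱ` stays DISPLAYED in every
theorem: `ϱ = ε∕σ` is the slack over the booked family's size, and the right-hand side `M∕(ϱ − 1) = M·σ∕(ε − σ)` (with
`M = e·ν·c₁·K₀²·A·e^{−r₁ d(X₀)}`, the (2.41) envelope) is the (w5) regeneration constant's READING `c̄` ALONG THE STRENGTH PENCIL —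
what is discharged below is (B1a) at the cores ∕ letters (complex differentiability and the majorant of the dressed activities in
`s`), NOT (w5) on Bałaban's densities.

HONEST FRAMING.  By-name composition over SHAPES: (B1a)'s (E1)∕(E2) half for the REGENERATION END is relocated onto row NE5's
exp-linear FORMAT hypothesis (§1∕§2) and onto S30's primitive scalar letter conditions (§3) — KERNEL only RELATIVE TO those displayed
inputs; (w5) NOT discharged on Bałaban's densities; (B1b) ∕ (B3) ∕ (B5) NOT discharged; 0 binders instantiated on Bałaban's densities; no new inequality; no wall item of NE1′ or
NE5 moves; the NE1′ wall wording of record v1.8 (T4-DAG v48) — words, not kind — does NOT move; R-t4r2-Q2 NOT met; ABSOLUTE RULE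
honoured ([folklore] kernel lemmas only; no disputed step of the audited manuscripts enters as a fact).  NE1′ ⇐ the named binders —
NOT proved, NOT printed; spine PROVED 0∕9; count 9 unchanged.  Rung (B)+1 on ONE finite four-torus — NOT infinite volume, NOT a
mass gap, NOT OS on ℝ⁴, NOT Clay.  HONEST DEPENDENCY: continuum YM on T⁴ ⇐ BetaPertH ∧ nine spine estimates (0/9 proved); BetaPertH
⇐ (D1) ∧ (D4) ∧ CAP+tail; G-an2-4 gates asym, D1 and NE2/3/4.
-/

noncomputable section

namespace Summit.QuantumFields.BalabanUV.T4Continuum.NE1p.DressedRegenerationOnCores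

open scoped BigOperators Matrix
open Metric Set MeasureTheory
open Literature.MathematicalPhysics.QuantumFieldTheory.Balaban1983to89
open Literature.MathematicalPhysics.QuantumFieldTheory.Balaban1983to89.T4OutputRate (Carriers)
open Literature.MathematicalPhysics.QuantumFieldTheory.Balaban1983to89.B13Resummation (locE Geometry)
open Literature.MathematicalPhysics.QuantumFieldTheory.Balaban1983to89.B5Prop11Lower (nsq)
open Summit.QuantumFields.BalabanUV.T4Continuum.B13HistMeasurable (MeasPotFrame B13HistM)
open Summit.QuantumFields.BalabanUV.T4Continuum.B13TermParamGaussianBi (BiCore)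
open Summit.QuantumFields.BalabanUV.T4Continuum.SubstrateTwoRunsDriven (DrivenRuns)
open Summit.QuantumFields.BalabanUV.T4Continuum.SubstrateActivities (CoreLetters coreOf actOfLetters)
open Summit.QuantumFields.BalabanUV.T4Continuum.SubstrateGaussianLetters (gaussC linForm)
open Summit.QuantumFields.BalabanUV.T4Continuum.SubstrateGaussianLettersBall (detBudget)
open Summit.QuantumFields.BalabanUV.T4Continuum.SubstrateSlotsOfRecord (ActLetters coreLettersOf)
open Summit.QuantumFields.BalabanUV.T4Continuum.NE1p.DressedSmallFieldOnCores (pencil_mem_ballClass norm_pencil_le)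
open Summit.QuantumFields.BalabanUV.T4Continuum.NE1p.DressedSmallFieldOnCoresMass (norm_integral_coreDensity_le)
open Summit.QuantumFields.BalabanUV.T4Continuum.NE1p.DressedSmallFieldOnCoresSlot (termHistExpLinear_termAt)
open Summit.QuantumFields.BalabanUV.T4Continuum.NE1p.DressedSmallFieldOnCoresSlotLetters (margin_pos hN_coreLettersOf
  hq_coreLettersOf)
open Summit.QuantumFields.BalabanUV.T4Continuum.NE1p.DressedSourceAnalyticOnCores (regenPart_locE_le_of_expLinear)

/-! ## §1 ON CORES WITH TERM-DEPENDENT POLYMER FAMILIES, STRENGTH PENCIL `h₀ + s • v` OF RADIUS `ϱ > 1`, (B3) AS N0q's LETTER BUDGET -/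

section Dep
variable {C : Carriers} {P : MeasPotFrame C} {Op : Type*} [NormedAddCommGroup Op] [NormedSpace ℂ Op] {ι : Type*}
  {𝒴 : ℕ → ι → Type*} {dom : ∀ k i, 𝒴 k i → C.Dom} {β : ℕ → ι → Type*} [∀ k i, MeasurableSpace (β k i)]
  {α : ℕ → ι → Type*} [∀ k i, NormedAddCommGroup (α k i)] [∀ k i, InnerProductSpace ℝ (α k i)]
  [∀ k i, FiniteDimensional ℝ (α k i)] [∀ k i, MeasurableSpace (α k i)] [∀ k i, BorelSpace (α k i)]
variable (D : LocDomainSys) {Cube : Type} [DecidableEq Cube] (G : Geometry D Cube)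

open Classical in
/-- **THE (w5) REGENERATION CONSTANT WITH DECAY FOR CORES WITH TERM-DEPENDENT POLYMER FAMILIES, (B1a) DISCHARGED, (B3) AS A LETTER
BUDGET** (kernel; S33 §2 `regenPart_locE_le_of_expLinear` ONCE BY NAME with `hexp := termHistExpLinear_termAt` (N0r §1), STRENGTH
pencil `s ↦ h₀ + s • v` on `‖s‖ < ϱ` kept in the class by N0p's `pencil_mem_ballClass` ∕ `norm_pencil_le` at radius `ϱ`, read-out
bounds by the cores' `N₁`, `hL3` from N0q's letter budget **`hM3`** via `norm_integral_coreDensity_le` termwise — S33 §3's proof with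
`μ₁ ↦ ϱ`).  Binders = S33 §3 `muDeriv_locE_le_of_coresAt_pencil_mass`'s with `μ₁ ↦ ϱ`, MINUS the window point [`μ₀`, `sμ`, `h01`,
`hμ`] PLUS [`hϱ : 1 < ϱ`].  Conclusion: `‖E[act 1](X₀) − E[act 0](X₀)‖ ≤ (e·ν·c₁·K₀²·A·e^{−r₁ d(X₀)})∕(ϱ − 1)` — the booked
family `s = 1` against the unregenerated one `s = 0`. [folklore] -/
theorem regenPart_locE_le_of_coresAt_pencil_mass {W : Set (ℕ → ℝ)}
    {ctr : ℕ → (ℕ → ℝ) → C.BgB → Op × B13HistM P} {ROp RHist R' : ℕ → ℝ}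
    (𝔊 : ∀ k i, C.Dom → BiCore P (dom k i) Op (β k i) (α k i)) {mq bq N₀ : ℕ → ι → C.Dom → ℝ} (hroom : ∀ k, ROp k < R' k)
    (hm : ∀ k, ∀ g ∈ W, ∀ (U : C.BgB) (X : C.Dom), C.scale X = k → ∀ i, 0 < mq k i X)
    (hN : ∀ k, ∀ g ∈ W, ∀ (U : C.BgB) (X : C.Dom), C.scale X = k → ∀ i,
      (∀ o ∈ ball (ctr k g U).1 (R' k), AEStronglyMeasurable ((𝔊 k i X).N o) (𝔊 k i X).lam) ∧
      (∀ p, DifferentiableOn ℂ (fun o => (𝔊 k i X).N o p) (ball (ctr k g U).1 (R' k))) ∧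
      (∀ o ∈ ball (ctr k g U).1 (R' k), ∀ p, ‖(𝔊 k i X).N o p‖ ≤ N₀ k i X))
    (hq : ∀ k, ∀ g ∈ W, ∀ (U : C.BgB) (X : C.Dom), C.scale X = k → ∀ i,
      (∀ o ∈ ball (ctr k g U).1 (R' k),
        AEStronglyMeasurable (Function.uncurry ((𝔊 k i X).q o)) ((𝔊 k i X).lam.prod volume)) ∧
      (∀ p v, DifferentiableOn ℂ (fun o => (𝔊 k i X).q o p v) (ball (ctr k g U).1 (R' k))) ∧
      (∀ o ∈ ball (ctr k g U).1 (R' k), ∀ p v, mq k i X * ‖v‖ ^ 2 - bq k i X ≤ ((𝔊 k i X).q o p v).re))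
    {k : ℕ} {g : ℕ → ℝ} (hg : g ∈ W) {U : C.BgB} {o : Op} {h₀ v : B13HistM P} {ϱ : ℝ}
    (hO : ‖o - (ctr k g U).1‖ ≤ ROp k) (hH : ‖h₀ - (ctr k g U).2‖ + ϱ * ‖v‖ ≤ RHist k)
    {emb : D.Dom → C.Dom} (hscale : ∀ Z, C.scale (emb Z) = k) {terms : D.Dom → Finset ι} {act : ℂ → D.Dom → ℂ}
    (hact : ∀ s ∈ ball (0 : ℂ) ϱ, ∀ Z, act s Z = ∑ i ∈ terms Z, (𝔊 k i (emb Z)).termAt o (h₀ + s • v))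
    {A R r₁ b₅ : ℝ} {X₀ : D.Dom} (hA : 0 ≤ A) (hr₁ : 0 ≤ r₁) (hb : r₁ * 5 ≤ b₅)
    (hrate : r₁ + 2 * G.κ₀ + 2 ≤ R) (hsmall : A * Real.exp (b₅ + 1) * G.K₀ * G.ν * G.c₁ ≤ 1) (hM3 : ∀ Z, G.cubes Z ⊆ G.cubes X₀ →
      ∑ i ∈ terms Z, (𝔊 k i (emb Z)).lam.real univ * ((𝔊 k i (emb Z)).wB * N₀ k i (emb Z) *
          Real.exp (bq k i (emb Z))) * (Real.pi / (mq k i (emb Z) / 2)) ^ (Module.finrank ℝ (α k i) / 2 : ℝ) *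
        Real.exp ((𝔊 k i (emb Z)).N₁ * (‖h₀‖ + ϱ * ‖v‖)) ≤ A * Real.exp (-(R * D.dj Z)))
    (hϱ : 1 < ϱ) :
    ‖locE G.ι G.cubes (act 1) (G.cubes X₀) - locE G.ι G.cubes (act 0) (G.cubes X₀)‖ ≤
      Real.exp 1 * G.ν * G.c₁ * G.K₀ ^ 2 * A * Real.exp (-(r₁ * D.dj X₀)) / (ϱ - 1) := by
  have ho : o ∈ ball (ctr k g U).1 (R' k) := mem_ball.2 (by rw [dist_eq_norm]; exact lt_of_le_of_lt hO (hroom k))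
  refine regenPart_locE_le_of_expLinear D G (termHistExpLinear_termAt 𝔊 hroom hm hN hq) hg (hc := fun s => h₀ + s • v)
    ((differentiable_const h₀).add (differentiable_id.smul_const v)).differentiableOn
    (fun _ hs => pencil_mem_ballClass hO hH hs) (fun _ hs => norm_pencil_le hs) hscale hact
    (fun Z i => (𝔊 k i (emb Z)).N₁_nonneg)
    (fun Z i _ => Filter.Eventually.of_forall fun z => (𝔊 k i (emb Z)).norm_readOut_le z.1 z.2)
    hA hr₁ hb hrate hsmall (fun Z hZ => le_trans ?_ (hM3 Z hZ)) hϱ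
  refine Finset.sum_le_sum fun i _ => mul_le_mul_of_nonneg_right ?_ (Real.exp_pos _).le
  simpa only [one_mul] using norm_integral_coreDensity_le (𝔊 k i (emb Z)) (hm k g hg U (emb Z) (hscale Z) i)
    (hN k g hg U (emb Z) (hscale Z) i).2.2 (hq k g hg U (emb Z) (hscale Z) i).2.2 ho

end Dep

/-! ## §2 AT THE SUBSTRATE'S LETTERS: the slot activities `actOfLetters ℓ` along the strength pencil — `hact` BY `rfl` -/

section Slot
variable {C : Carriers} (P : MeasPotFrame C) (Op : Type*) [NormedAddCommGroup Op] [NormedSpace ℂ Op] {Pol J : Type*}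
  (𝒴 : Pol → J → Type) [∀ Z j, Fintype (𝒴 Z j)] (dom : ∀ Z j, 𝒴 Z j → C.Dom)
  (Jc : Pol → J → Type) [∀ Z j, Fintype (Jc Z j)]
  (V : Pol → J → Type) [∀ Z j, NormedAddCommGroup (V Z j)] [∀ Z j, InnerProductSpace ℝ (V Z j)]
  [∀ Z j, MeasurableSpace (V Z j)] [∀ Z j, BorelSpace (V Z j)] [∀ Z j, FiniteDimensional ℝ (V Z j)]
variable (D : LocDomainSys) {Cube : Type} [DecidableEq Cube] (G : Geometry D Cube)

open Classical in
/-- **THE (w5) REGENERATION CONSTANT OF THE DRESSED OUTPUT OF THE SUBSTRATE'S SLOT ACTIVITIES** (kernel; §1 at the term index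
`Pol × J`, `𝔊 k p X := coreOf ℓ p.1 p.2`, dressed activity of the polymer `Z` along the strength pencil := `Σ_{p ∈ terms Z} actOfLetters
ℓ p.1 p.2 o (h₀ + s • v)` — `hact` BY `rfl`; S33 §4's pattern).  Binders = S33 §4 `muDeriv_locE_le_of_actOfLetters`'s with `μ₁ ↦ ϱ`,
MINUS [`μ₀`, `sμ`, `h01`, `hμ`] PLUS [`hϱ : 1 < ϱ`].  Conclusion: `‖E[Σ actOfLetters … o (h₀ + v)](X₀) − E[Σ actOfLetters … o
h₀](X₀)‖ ≤ (e·ν·c₁·K₀²·A·e^{−r₁ d(X₀)})∕(ϱ − 1)` — written LITERALLY at `s = 1` and `s = 0` of the pencil. [folklore] -/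
theorem regenPart_locE_le_of_actOfLetters {W : Set (ℕ → ℝ)} {ctr : ℕ → (ℕ → ℝ) → C.BgB → Op × B13HistM P}
    {ROp RHist R' : ℕ → ℝ} (ℓ : ∀ Z j, CoreLetters P Op 𝒴 dom Jc V Z j) {mq bq N₀ : ℕ → Pol × J → C.Dom → ℝ}
    (hroom : ∀ k, ROp k < R' k) (hm : ∀ k, ∀ g ∈ W, ∀ (U : C.BgB) (X : C.Dom), C.scale X = k → ∀ p, 0 < mq k p X)
    (hN : ∀ k, ∀ g ∈ W, ∀ (U : C.BgB) (X : C.Dom), C.scale X = k → ∀ p : Pol × J,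
      (∀ o ∈ ball (ctr k g U).1 (R' k),
        AEStronglyMeasurable ((ℓ p.1 p.2).N o) (coreOf P Op 𝒴 dom Jc V ℓ p.1 p.2).lam) ∧
      (∀ a, DifferentiableOn ℂ (fun o => (ℓ p.1 p.2).N o a) (ball (ctr k g U).1 (R' k))) ∧
      (∀ o ∈ ball (ctr k g U).1 (R' k), ∀ a, ‖(ℓ p.1 p.2).N o a‖ ≤ N₀ k p X))
    (hq : ∀ k, ∀ g ∈ W, ∀ (U : C.BgB) (X : C.Dom), C.scale X = k → ∀ p : Pol × J,
      (∀ o ∈ ball (ctr k g U).1 (R' k),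
        AEStronglyMeasurable (Function.uncurry ((ℓ p.1 p.2).q o))
          ((coreOf P Op 𝒴 dom Jc V ℓ p.1 p.2).lam.prod volume)) ∧
      (∀ a v, DifferentiableOn ℂ (fun o => (ℓ p.1 p.2).q o a v) (ball (ctr k g U).1 (R' k))) ∧
      (∀ o ∈ ball (ctr k g U).1 (R' k), ∀ a v, mq k p X * ‖v‖ ^ 2 - bq k p X ≤ ((ℓ p.1 p.2).q o a v).re))
    {k : ℕ} {g : ℕ → ℝ} (hg : g ∈ W) {U : C.BgB} {o : Op} {h₀ v : B13HistM P} {ϱ : ℝ}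
    (hO : ‖o - (ctr k g U).1‖ ≤ ROp k) (hH : ‖h₀ - (ctr k g U).2‖ + ϱ * ‖v‖ ≤ RHist k)
    {emb : D.Dom → C.Dom} (hscale : ∀ Z, C.scale (emb Z) = k) (terms : D.Dom → Finset (Pol × J))
    {A R r₁ b₅ : ℝ} {X₀ : D.Dom} (hA : 0 ≤ A) (hr₁ : 0 ≤ r₁) (hb : r₁ * 5 ≤ b₅)
    (hrate : r₁ + 2 * G.κ₀ + 2 ≤ R) (hsmall : A * Real.exp (b₅ + 1) * G.K₀ * G.ν * G.c₁ ≤ 1) (hM3 : ∀ Z, G.cubes Z ⊆ G.cubes X₀ →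
      ∑ p ∈ terms Z, (coreOf P Op 𝒴 dom Jc V ℓ p.1 p.2).lam.real univ *
          ((coreOf P Op 𝒴 dom Jc V ℓ p.1 p.2).wB * N₀ k p (emb Z) * Real.exp (bq k p (emb Z))) *
          (Real.pi / (mq k p (emb Z) / 2)) ^ (Module.finrank ℝ (V p.1 p.2) / 2 : ℝ) *
        Real.exp ((coreOf P Op 𝒴 dom Jc V ℓ p.1 p.2).N₁ * (‖h₀‖ + ϱ * ‖v‖)) ≤ A * Real.exp (-(R * D.dj Z)))
    (hϱ : 1 < ϱ) :
    ‖locE G.ι G.cubes (fun Z => ∑ p ∈ terms Z, actOfLetters P Op 𝒴 dom Jc V ℓ p.1 p.2 o (h₀ + (1 : ℂ) • v)) (G.cubes X₀) -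
        locE G.ι G.cubes (fun Z => ∑ p ∈ terms Z, actOfLetters P Op 𝒴 dom Jc V ℓ p.1 p.2 o (h₀ + (0 : ℂ) • v)) (G.cubes X₀)‖ ≤
      Real.exp 1 * G.ν * G.c₁ * G.K₀ ^ 2 * A * Real.exp (-(r₁ * D.dj X₀)) / (ϱ - 1) :=
  regenPart_locE_le_of_coresAt_pencil_mass D G (ι := Pol × J)
    (fun (_ : ℕ) (p : Pol × J) (_ : C.Dom) => coreOf P Op 𝒴 dom Jc V ℓ p.1 p.2) hroom hm hN hq hg hO hH hscale
    (terms := terms) (act := fun s Z => ∑ p ∈ terms Z, actOfLetters P Op 𝒴 dom Jc V ℓ p.1 p.2 o (h₀ + s • v))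
    (fun _ _ _ => rfl) hA hr₁ hb hrate hsmall hM3 hϱ

end Slot

/-! ## §3 AT THE GAUSSIAN LETTERS OF RECORD `coreLettersOf A`, N0r's operator-letter blocks DISCHARGED by S30 §1 -/

section CoreLettersOf

variable {G : Type} [GaugeGroup G] (D : DrivenRuns G) (P : MeasPotFrame D.carriers)
variable (Op : Type) [NormedAddCommGroup Op] [NormedSpace ℂ Op] {J : Type}
  (𝒵 : D.carriers.Dom → J → Type) [∀ Z j, Fintype (𝒵 Z j)] (dom : ∀ Z j, 𝒵 Z j → D.carriers.Dom)
  (Jc : D.carriers.Dom → J → Type) [∀ Z j, Fintype (Jc Z j)]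
  (V : D.carriers.Dom → J → Type) [∀ Z j, NormedAddCommGroup (V Z j)] [∀ Z j, InnerProductSpace ℝ (V Z j)]
  [∀ Z j, MeasurableSpace (V Z j)] [∀ Z j, BorelSpace (V Z j)] [∀ Z j, FiniteDimensional ℝ (V Z j)]
  (mI : D.carriers.Dom → J → Type) [∀ Z j, Fintype (mI Z j)] [∀ Z j, DecidableEq (mI Z j)]
variable (𝔇 : LocDomainSys) {Cube : Type} [DecidableEq Cube] (Ge : Geometry 𝔇 Cube)

open Classical in
/-- **THE (w5) REGENERATION CONSTANT OF THE DRESSED OUTPUT OF THE SLOT ACTIVITIES AT THE CORE LETTERS OF RECORD, OPERATOR LETTERS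
DISCHARGED** (kernel; §2 `regenPart_locE_le_of_actOfLetters` ONCE BY NAME at `ℓ := coreLettersOf D P Op 𝒵 dom Jc V mI A`, letters
`N₀ k p X := gaussC (mI p.1 p.2)·√(max 1 (card!·β₀ Z′ j^{card} + d₀ Z′ j))`, `mq k p X := (γ Z′ j − card·ϑ Z′ j·R′ k)/2`, `bq := 0`,
blocks `hm` ∕ `hN` ∕ `hq` from S30 §1 `margin_pos` ∕ `hN_coreLettersOf` ∕ `hq_coreLettersOf` — S46 §2's pattern VERBATIM).  Binders =
S46 §2 `muDeriv_locE_le_of_coreLettersOf`'s with `μ₁ ↦ ϱ`, MINUS [`μ₀`, `sμ`, `h01`, `hμ`] PLUS [`hϱ : 1 < ϱ`]: `hroom`, `0 ≤ R′ k`;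
the substrate's primitive letter conditions `hbase` ∕ `hrdm` ∕ `hβ₀` ∕ `hd₀` ∕ `hrd`, the CENTRE CONDITIONS `hctr`, the radius
smallnesses `hbud` ∕ `hmq`; `hO` ∕ `hH` at the strength radius `ϱ`; `hscale`, `terms`; the clauses; (B3) `hM3` on the explicit
letters.  Conclusion: `‖E[Σ actOfLetters (coreLettersOf A) … o (h₀ + v)](X₀) − E[Σ actOfLetters (coreLettersOf A) … o h₀](X₀)‖ ≤
(e·ν·c₁·K₀²·A′·e^{−r₁ d(X₀)})∕(ϱ − 1)`.  Nothing of the substrate's data is asserted. [folklore] -/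
theorem regenPart_locE_le_of_coreLettersOf {W : Set (ℕ → ℝ)} {ctr : ℕ → (ℕ → ℝ) → D.carriers.BgB → Op × B13HistM P}
    {ROp RHist R' : ℕ → ℝ} (A : ∀ Z j, ActLetters D P Op 𝒵 dom Jc V mI Z j) {β₀ ϑ d₀ γ : D.carriers.Dom → J → ℝ}
    (hroom : ∀ k, ROp k < R' k) (hR' : ∀ k, 0 ≤ R' k)
    (hbase : ∀ Z j ii jj, Measurable fun a => (A Z j).base a ii jj)
    (hrdm : ∀ Z j ii jj (o' : Op), Measurable fun a => (A Z j).rd a ii jj o')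
    (hβ₀ : ∀ Z j, 0 ≤ β₀ Z j) (hd₀ : ∀ Z j, 0 < d₀ Z j)
    (hrd : ∀ Z j a ii jj, ‖(A Z j).rd a ii jj‖ ≤ ϑ Z j)
    (hctr : ∀ k, ∀ g ∈ W, ∀ (U : D.carriers.BgB) (Z : D.carriers.Dom) (j : J) (a : (Jc Z j ⊕ 𝒵 Z j) → ℝ × ℝ),
      (∀ ii jj, ‖linForm (A Z j).base (A Z j).rd (ctr k g U).1 a ii jj‖ ≤ β₀ Z j) ∧
      ((linForm (A Z j).base (A Z j).rd (ctr k g U).1 a).det).im = 0 ∧ d₀ Z j ≤ ((linForm (A Z j).base (A Z j).rd (ctr k g U).1 a).det).re ∧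
      (∀ x : mI Z j → ℂ, γ Z j * nsq x ≤ (star x ⬝ᵥ (linForm (A Z j).base (A Z j).rd (ctr k g U).1 a *ᵥ x)).re))
    (hbud : ∀ k Z j, detBudget (Fintype.card (mI Z j)) (β₀ Z j) (ϑ Z j) (R' k) < d₀ Z j)
    (hmq : ∀ k Z j, Fintype.card (mI Z j) * ϑ Z j * R' k < γ Z j)
    {k : ℕ} {g : ℕ → ℝ} (hg : g ∈ W) {U : D.carriers.BgB} {o : Op} {h₀ v : B13HistM P} {ϱ : ℝ}
    (hO : ‖o - (ctr k g U).1‖ ≤ ROp k) (hH : ‖h₀ - (ctr k g U).2‖ + ϱ * ‖v‖ ≤ RHist k)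
    {emb : 𝔇.Dom → D.carriers.Dom} (hscale : ∀ Z, D.carriers.scale (emb Z) = k)
    (terms : 𝔇.Dom → Finset (D.carriers.Dom × J))
    {A' R r₁ b₅ : ℝ} {X₀ : 𝔇.Dom} (hA : 0 ≤ A') (hr₁ : 0 ≤ r₁) (hb : r₁ * 5 ≤ b₅)
    (hrate : r₁ + 2 * Ge.κ₀ + 2 ≤ R) (hsmall : A' * Real.exp (b₅ + 1) * Ge.K₀ * Ge.ν * Ge.c₁ ≤ 1)
    (hM3 : ∀ Z, Ge.cubes Z ⊆ Ge.cubes X₀ →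
      ∑ p ∈ terms Z, (coreOf P Op 𝒵 dom Jc V (coreLettersOf D P Op 𝒵 dom Jc V mI A) p.1 p.2).lam.real univ *
          ((coreOf P Op 𝒵 dom Jc V (coreLettersOf D P Op 𝒵 dom Jc V mI A) p.1 p.2).wB *
              (gaussC (mI p.1 p.2) * Real.sqrt (max 1 ((Fintype.card (mI p.1 p.2)).factorial *
                β₀ p.1 p.2 ^ Fintype.card (mI p.1 p.2) + d₀ p.1 p.2))) * Real.exp 0) *
          (Real.pi / ((γ p.1 p.2 - Fintype.card (mI p.1 p.2) * ϑ p.1 p.2 * R' k) / 2 / 2)) ^ (Module.finrank ℝ (V p.1 p.2) / 2 : ℝ) *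
        Real.exp ((coreOf P Op 𝒵 dom Jc V (coreLettersOf D P Op 𝒵 dom Jc V mI A) p.1 p.2).N₁ * (‖h₀‖ + ϱ * ‖v‖)) ≤
        A' * Real.exp (-(R * 𝔇.dj Z)))
    (hϱ : 1 < ϱ) :
    ‖locE Ge.ι Ge.cubes (fun Z => ∑ p ∈ terms Z,
          actOfLetters P Op 𝒵 dom Jc V (coreLettersOf D P Op 𝒵 dom Jc V mI A) p.1 p.2 o (h₀ + (1 : ℂ) • v)) (Ge.cubes X₀) -
        locE Ge.ι Ge.cubes (fun Z => ∑ p ∈ terms Z,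
          actOfLetters P Op 𝒵 dom Jc V (coreLettersOf D P Op 𝒵 dom Jc V mI A) p.1 p.2 o (h₀ + (0 : ℂ) • v)) (Ge.cubes X₀)‖ ≤
      Real.exp 1 * Ge.ν * Ge.c₁ * Ge.K₀ ^ 2 * A' * Real.exp (-(r₁ * 𝔇.dj X₀)) / (ϱ - 1) :=
  regenPart_locE_le_of_actOfLetters P Op 𝒵 dom Jc V 𝔇 Ge (coreLettersOf D P Op 𝒵 dom Jc V mI A)
    (mq := fun k p _ => (γ p.1 p.2 - Fintype.card (mI p.1 p.2) * ϑ p.1 p.2 * R' k) / 2) (bq := fun _ _ _ => 0)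
    (N₀ := fun _ p _ => gaussC (mI p.1 p.2) *
      Real.sqrt (max 1 ((Fintype.card (mI p.1 p.2)).factorial * β₀ p.1 p.2 ^ Fintype.card (mI p.1 p.2) + d₀ p.1 p.2)))
    hroom (margin_pos D mI hmq) (hN_coreLettersOf D P Op 𝒵 dom Jc V mI A hR' hbase hrdm hβ₀ hd₀ hrd hctr hbud)
    (hq_coreLettersOf D P Op 𝒵 dom Jc V mI A hbase hrdm hrd hctr) hg hO hH hscale terms hA hr₁ hb hrate hsmall hM3 hϱ

end CoreLettersOf

end Summit.QuantumFields.BalabanUV.T4Continuum.NE1p.DressedRegenerationOnCores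

end
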